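import Literature.NumberTheory.Sieve.DeshouillersIwaniecLargeSieveMaassKloo
import Mathlib.Analysis.MeanInequalities
import Mathlib.Analysis.SpecificLimits.Basic
import HarnessLib

/-!
# The large sieve inequalities for Maass and Eisenstein coefficients (Deshouillers–Iwaniec, Theorem 2 (1.29)–(1.30))

Third step: from Kuznetsov's formula in its spectral form [Iwaniec2002, Theorem 9.3 (9.12)], taken as
a HYPOTHESIS on abstract coefficient arrays — the predicate `KuzGaussFamily` (the formula divided by
`4π`, for the Gaussian test functions `h_K(t) = πt coth(πt) e^{−t²/K²}`, `K ≥ 1`, of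
`DeshouillersIwaniecKuznetsovKernel`, with Kloosterman side `Σ_c kuzTerm r K m n c` of
`DeshouillersIwaniecLargeSieveMaassKloo`) — we PROVE the large sieve inequalities
[DeshouillersIwaniec1982, Theorem 2 (1.29)–(1.30)] in the shape of the tree's hypotheses
`BFI.L1.LSMaassInfAt` / `LSEisInfAt` (`largeSieve_maass_eis`):

* `specSide_le`: multiplying the formula by `ā_m a_n` and summing over `N < m, n ≤ 2N`, the three
  spectral pieces are nonnegative (`h_K ≥ 0`, `h_K(iy) ≥ √2/2`) and their sum equals
  `h₀‖a‖²/(4π) + Σ_c T_c`, so each finite piece is `≤ h₀(K)‖a‖²/(4π) + Σ_c ‖T_c‖`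
  ([DeshouillersIwaniec1982, (5.5)]), and `Σ_c ‖T_c‖ ≤ C K N^{1+6ε}/r ‖a‖²` by `kloostermanSide_le`;
* the dyadic shells `K_j = (T+1)/2^j`, `j ≤ J = log₂⌊T+1⌋` in the spectral parameter: for `|t| ≤ T`
  some shell has `K_j/2 < |t| + 1 ≤ K_j`, where `h_{K_j}(t) ≥ e⁻¹ max(1, π|t|) > K_j/(4e)`; hence
  `1 ≤ 4e Σ_j h_{K_j}(t)/K_j` (`one_le_shellSum`), which turns `h₀(K)/K ∼ K²` into `Σ_j K_j² ≤ (4/3)(T+1)²`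
  and costs a factor `J + 1 ≤ C_δ (T+1)^δ`, absorbed by Young's inequality
  ([DeshouillersIwaniec1982, p. 261: "`≪ (K² + μN^{1+ε} log 2K)‖a‖² ≪ (K² + μN^{1+2ε})‖a‖²`"]).

## References
* [DeshouillersIwaniec1982] J.-M. Deshouillers, H. Iwaniec, *Kloosterman sums and Fourier coefficients
  of cusp forms*, Invent. Math. 70 (1982): Theorem 2 (1.29)–(1.30), §5.3 pp. 260–261.
* [Iwaniec2002] H. Iwaniec, *Spectral methods of automorphic forms*, 2nd ed., GSM 53: Theorem 9.3 (9.12),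
  (8.5)–(8.6).
-/

noncomputable section

open Real MeasureTheory Set Filter
open scoped Topology

namespace Literature.NumberTheory.Sieve

namespace DeshouillersIwaniec


section Spectral

open Finset Complex BFI LargeSieve Literature.Analysis.FunctionSpaces
open scoped ComplexConjugate

/-- **Hypothesis: Kuznetsov's formula [Iwaniec2002, Theorem 9.3 (9.12)] for the Gaussian test functions
`h_K` (`K ≥ 1`) at level `r`, one cusp `𝔞 = 𝔟`, divided by `4π`**, for abstract coefficient arrays
`P : ι → ℕ → ℂ` (Maass cusp forms with real spectral parameters `tf`), `Pe : ιe → ℕ → ℂ` (exceptional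
forms, `t_f = i y_f`, `0 < y_f ≤ 1/4` by Selberg's `λ₁ ≥ 3/16` [DeshouillersIwaniec1982, Theorem 4]),
`PE : Fin nc → ℝ → ℕ → ℂ` (Eisenstein series at the `nc` singular cusps), in the normalisation
`ν̄_{𝔞j}(m)ν_{𝔞j}(n) = (4π/ch πt_j) conj(P f m) P f n` of [Iwaniec2002, (8.5)–(8.6)] (the tree's
`BFI.L1.SpecData`, `P f n = √n ρ_f(n)`): for `m, n ≥ 1`,
`Σ_f h_K(t_f) conj(P f m) P f n/ch(πt_f) + Σ_f h_K(iy_f) conj(Pe f m) Pe f n/cos(πy_f)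
  + Σ_𝔠 (1/4π)∫ h_K(t) conj(PE 𝔠 t m) PE 𝔠 t n/ch(πt) dt = δ_{mn} h₀/(4π) + Σ_c kuzTerm r K m n c`,
the series converging absolutely enough (`HasSum`) and the Eisenstein integrands integrable.
[cite: Iwaniec2002, Theorem 9.3 (9.12); DeshouillersIwaniec1982, Theorem 1, §5.3 p. 260] -/
def KuzGaussFamily (ι : Type*) (tf : ι → ℝ) (P : ι → ℕ → ℂ) (ιe : Type*) (y : ιe → ℝ) (Pe : ιe → ℕ → ℂ)
    (nc : ℕ) (PE : Fin nc → ℝ → ℕ → ℂ) (r : ℕ) : Prop :=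
  (∀ f, 0 < y f ∧ y f ≤ 1 / 4) ∧
  ∀ K : ℝ, 1 ≤ K → ∀ m n : ℕ, 1 ≤ m → 1 ≤ n →
    ∃ vM vX : ℂ,
      HasSum (fun f => ((hGauss K (tf f) / Real.cosh (π * tf f) : ℝ) : ℂ) * conj (P f m) * P f n) vM ∧
      HasSum (fun f => ((hGaussExc K (y f) / Real.cos (π * y f) : ℝ) : ℂ) * conj (Pe f m) * Pe f n) vX ∧
      (∀ 𝔠, Integrable (fun t => ((hGauss K t / Real.cosh (π * t) : ℝ) : ℂ) * conj (PE 𝔠 t m) * PE 𝔠 t n)) ∧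
      vM + vX + ∑ 𝔠, (1 / (4 * π) : ℂ) * ∫ t, ((hGauss K t / Real.cosh (π * t) : ℝ) : ℂ) * conj (PE 𝔠 t m) * PE 𝔠 t n =
        (if m = n then ((hZero K / (4 * π) : ℝ) : ℂ) else 0) + ∑' c, kuzTerm r K m n c

/-- `∑_{m,n} ā_m a_n w (conj (F m) F n) = w ‖∑_n a_n F n‖²`. [folklore] -/
theorem sum_sum_weight_eq (D : Finset ℕ) (a : ℕ → ℂ) (F : ℕ → ℂ) (w : ℂ) :
    ∑ m ∈ D, ∑ n ∈ D, conj (a m) * a n * (w * conj (F m) * F n) = w * (((‖∑ n ∈ D, a n * F n‖ ^ 2 : ℝ)) : ℂ) := by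
  rw [normSq_sum_eq, Finset.mul_sum]
  refine Finset.sum_congr rfl fun m _ => ?_
  rw [Finset.mul_sum]
  refine Finset.sum_congr rfl fun n _ => ?_
  ring

/-- `∑_{m,n ∼ N} ā_m a_n (δ_{mn} d) = d ‖a‖²`. [folklore] -/
theorem sum_sum_ite_const (N : ℝ) (a : ℕ → ℂ) (d : ℂ) :
    ∑ m ∈ dyadic N, ∑ n ∈ dyadic N, conj (a m) * a n * (if m = n then d else 0) = d * (l2 N a : ℂ) := by
  rw [← sum_sum_ite_eq_l2, Finset.mul_sum]
  refine Finset.sum_congr rfl fun m _ => ?_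
  rw [Finset.mul_sum]
  refine Finset.sum_congr rfl fun n _ => ?_
  split_ifs <;> ring

/-- **The spectral side is dominated by the diagonal and the Kloosterman side** (multiply the formula by
`ā_m a_n`, sum over `N < m, n ≤ 2N`, use positivity; [DeshouillersIwaniec1982, p. 260 (5.5)]):
for any finite sets `F`, `Fe` of forms,
`Σ_{f∈F} h_K(t_f)|Σ a P f|²/ch(πt_f) + Σ_{f∈Fe} h_K(iy_f)|Σ a Pe f|²/cos(πy_f) + Σ_𝔠 (1/4π)∫ h_K|Σ a PE|²/ch
  ≤ h₀(K)‖a‖²/(4π) + Σ_c ‖T_c‖`. [cite: DeshouillersIwaniec1982, §5.3 (5.5)] -/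
theorem specSide_le {ι : Type*} {tf : ι → ℝ} {P : ι → ℕ → ℂ} {ιe : Type*} {y : ιe → ℝ} {Pe : ιe → ℕ → ℂ}
    {nc : ℕ} {PE : Fin nc → ℝ → ℕ → ℂ} {r : ℕ} (hfam : KuzGaussFamily ι tf P ιe y Pe nc PE r)
    {K : ℝ} (hK : 1 ≤ K) {N : ℝ} (hN : 0 ≤ N) (a : ℕ → ℂ) (hT : Summable fun c => ‖Tc r K N a c‖)
    (F : Finset ι) (Fe : Finset ιe) :
    (∀ 𝔠, Integrable (fun t => hGauss K t / Real.cosh (π * t) * ‖∑ n ∈ dyadic N, a n * PE 𝔠 t n‖ ^ 2)) ∧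
    ∑ f ∈ F, hGauss K (tf f) / Real.cosh (π * tf f) * ‖∑ n ∈ dyadic N, a n * P f n‖ ^ 2 +
      ∑ f ∈ Fe, hGaussExc K (y f) / Real.cos (π * y f) * ‖∑ n ∈ dyadic N, a n * Pe f n‖ ^ 2 +
      ∑ 𝔠, 1 / (4 * π) * ∫ t, hGauss K t / Real.cosh (π * t) * ‖∑ n ∈ dyadic N, a n * PE 𝔠 t n‖ ^ 2 ≤
      hZero K / (4 * π) * l2 N a + ∑' c, ‖Tc r K N a c‖ := by
  obtain ⟨hy, hf⟩ := hfam
  have hπ := Real.pi_pos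
  -- notation
  set D := dyadic N with hD
  set wM : ι → ℝ := fun f => hGauss K (tf f) / Real.cosh (π * tf f) with hwM
  set wX : ιe → ℝ := fun f => hGaussExc K (y f) / Real.cos (π * y f) with hwX
  set wE : ℝ → ℝ := fun t => hGauss K t / Real.cosh (π * t) with hwE
  set FM : ℕ → ℕ → ι → ℂ := fun m n f => (wM f : ℂ) * conj (P f m) * P f n with hFM
  set FX : ℕ → ℕ → ιe → ℂ := fun m n f => (wX f : ℂ) * conj (Pe f m) * Pe f n with hFX
  set FE : ℕ → ℕ → Fin nc → ℝ → ℂ := fun m n 𝔠 t => (wE t : ℂ) * conj (PE 𝔠 t m) * PE 𝔠 t n with hFE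
  have hmem : ∀ {m}, m ∈ D → 1 ≤ m := fun hm => pos_of_mem_dyadic hN hm
  -- the formula for `m, n ∈ D`
  have hform : ∀ m ∈ D, ∀ n ∈ D, Summable (FM m n) ∧ Summable (FX m n) ∧ (∀ 𝔠, Integrable (FE m n 𝔠)) ∧
      (∑' f, FM m n f) + (∑' f, FX m n f) + ∑ 𝔠, (1 / (4 * π) : ℂ) * ∫ t, FE m n 𝔠 t =
        (if m = n then ((hZero K / (4 * π) : ℝ) : ℂ) else 0) + ∑' c, kuzTerm r K m n c := by
    intro m hm n hn
    obtain ⟨vM, vX, hM, hX, hI, hEq⟩ := hf K hK m n (hmem hm) (hmem hn)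
    refine ⟨hM.summable, hX.summable, hI, ?_⟩
    rw [hM.tsum_eq, hX.tsum_eq]
    exact hEq
  -- (1) the three spectral pieces summed against `ā_m a_n`
  have hsumM : HasSum (fun f => (wM f : ℂ) * (((‖∑ n ∈ D, a n * P f n‖ ^ 2 : ℝ)) : ℂ))
      (∑ m ∈ D, ∑ n ∈ D, conj (a m) * a n * ∑' f, FM m n f) := by
    have h := hasSum_sum (s := D) fun m hm => hasSum_sum (s := D) fun n hn =>
      ((hform m hm n hn).1.hasSum).mul_left (conj (a m) * a n)
    have hfun : (fun f => ∑ m ∈ D, ∑ n ∈ D, conj (a m) * a n * FM m n f) =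
        fun f => (wM f : ℂ) * (((‖∑ n ∈ D, a n * P f n‖ ^ 2 : ℝ)) : ℂ) := by
      funext f; simp only [hFM]; exact sum_sum_weight_eq D a (P f) (wM f)
    rwa [hfun] at h
  have hsumX : HasSum (fun f => (wX f : ℂ) * (((‖∑ n ∈ D, a n * Pe f n‖ ^ 2 : ℝ)) : ℂ))
      (∑ m ∈ D, ∑ n ∈ D, conj (a m) * a n * ∑' f, FX m n f) := by
    have h := hasSum_sum (s := D) fun m hm => hasSum_sum (s := D) fun n hn =>
      ((hform m hm n hn).2.1.hasSum).mul_left (conj (a m) * a n)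
    have hfun : (fun f => ∑ m ∈ D, ∑ n ∈ D, conj (a m) * a n * FX m n f) =
        fun f => (wX f : ℂ) * (((‖∑ n ∈ D, a n * Pe f n‖ ^ 2 : ℝ)) : ℂ) := by
      funext f; simp only [hFX]; exact sum_sum_weight_eq D a (Pe f) (wX f)
    rwa [hfun] at h
  -- Eisenstein: the paired integrand and its integrability
  set gC : Fin nc → ℝ → ℂ := fun 𝔠 t => ∑ m ∈ D, ∑ n ∈ D, conj (a m) * a n * FE m n 𝔠 t with hgC
  set g : Fin nc → ℝ → ℝ := fun 𝔠 t => wE t * ‖∑ n ∈ D, a n * PE 𝔠 t n‖ ^ 2 with hg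
  have hgCint : ∀ 𝔠, Integrable (gC 𝔠) := fun 𝔠 =>
    integrable_finsetSum _ fun m hm => integrable_finsetSum _ fun n hn => ((hform m hm n hn).2.2.1 𝔠).const_mul _
  have hgC_eq : ∀ 𝔠 t, gC 𝔠 t = ((g 𝔠 t : ℝ) : ℂ) := by
    intro 𝔠 t
    simp only [hgC, hg, hFE]
    rw [sum_sum_weight_eq D a (PE 𝔠 t) (wE t)]
    push_cast; ring
  have hgint : ∀ 𝔠, Integrable (g 𝔠) := by
    intro 𝔠
    have h := (hgCint 𝔠).re
    refine h.congr (Eventually.of_forall fun t => ?_)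
    simp only []
    rw [hgC_eq]; simp
  have hEis : ∀ 𝔠, ∑ m ∈ D, ∑ n ∈ D, conj (a m) * a n * ((1 / (4 * π) : ℂ) * ∫ t, FE m n 𝔠 t) =
      (1 / (4 * π) : ℂ) * (((∫ t, g 𝔠 t : ℝ)) : ℂ) := by
    intro 𝔠
    have hcomm := (Complex.ofRealCLM.integral_comp_comm (hgint 𝔠)).symm
    simp only [Complex.ofRealCLM_apply] at hcomm
    rw [hcomm]
    have : (∫ t, ((g 𝔠 t : ℝ) : ℂ)) = ∫ t, gC 𝔠 t := integral_congr_ae (Eventually.of_forall fun t => (hgC_eq 𝔠 t).symm)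
    rw [this, hgC, integral_finsetSum _ fun m hm => integrable_finsetSum _ fun n hn => ((hform m hm n hn).2.2.1 𝔠).const_mul _,
      Finset.mul_sum]
    refine Finset.sum_congr rfl fun m hm => ?_
    rw [integral_finsetSum _ fun n hn => ((hform m hm n hn).2.2.1 𝔠).const_mul _, Finset.mul_sum]
    refine Finset.sum_congr rfl fun n hn => ?_
    rw [integral_const_mul]; ring
  -- (2) the right-hand side summed
  have hdiag : ∑ m ∈ D, ∑ n ∈ D, conj (a m) * a n * (if m = n then ((hZero K / (4 * π) : ℝ) : ℂ) else 0) =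
      ((hZero K / (4 * π) : ℝ) : ℂ) * (l2 N a : ℂ) := sum_sum_ite_const N a _
  have hkloo : ∑ m ∈ D, ∑ n ∈ D, conj (a m) * a n * ∑' c, kuzTerm r K m n c = ∑' c, Tc r K N a c := by
    have hs : ∀ m n, Summable fun c => conj (a m) * a n * kuzTerm r K m n c := fun m n =>
      (summable_kuzTerm r hK m n).mul_left _
    simp_rw [← tsum_mul_left]
    rw [show (∑ m ∈ D, ∑ n ∈ D, ∑' c, conj (a m) * a n * kuzTerm r K m n c) =
        ∑ m ∈ D, ∑' c, ∑ n ∈ D, conj (a m) * a n * kuzTerm r K m n c from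
      Finset.sum_congr rfl fun m _ => (Summable.tsum_finsetSum (fun n _ => hs m n)).symm]
    rw [← Summable.tsum_finsetSum (fun m _ => summable_sum fun n _ => hs m n)]
    rfl
  -- (3) sum the formula
  set VM := ∑ m ∈ D, ∑ n ∈ D, conj (a m) * a n * ∑' f, FM m n f with hVM
  set VX := ∑ m ∈ D, ∑ n ∈ D, conj (a m) * a n * ∑' f, FX m n f with hVX
  have hidentity : VM + VX + ∑ 𝔠, (1 / (4 * π) : ℂ) * (((∫ t, g 𝔠 t : ℝ)) : ℂ) =
      ((hZero K / (4 * π) : ℝ) : ℂ) * (l2 N a : ℂ) + ∑' c, Tc r K N a c := by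
    have h := Finset.sum_congr rfl fun m hm => Finset.sum_congr rfl fun n hn =>
      congrArg (fun z => conj (a m) * a n * z) (hform m hm n hn).2.2.2
    -- `h : Σ Σ ā a (LHS) = Σ Σ ā a (RHS)`
    simp only [mul_add, Finset.sum_add_distrib] at h
    rw [hdiag, hkloo] at h
    rw [← h, hVM, hVX]
    congr 1
    have hswap : (∑ m ∈ D, ∑ n ∈ D, conj (a m) * a n * ∑ 𝔠 : Fin nc, (1 / (4 * π) : ℂ) * ∫ t, FE m n 𝔠 t) =
        ∑ 𝔠 : Fin nc, ∑ m ∈ D, ∑ n ∈ D, conj (a m) * a n * ((1 / (4 * π) : ℂ) * ∫ t, FE m n 𝔠 t) := by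
      calc (∑ m ∈ D, ∑ n ∈ D, conj (a m) * a n * ∑ 𝔠 : Fin nc, (1 / (4 * π) : ℂ) * ∫ t, FE m n 𝔠 t)
          = ∑ m ∈ D, ∑ n ∈ D, ∑ 𝔠 : Fin nc, conj (a m) * a n * ((1 / (4 * π) : ℂ) * ∫ t, FE m n 𝔠 t) := by
            simp_rw [Finset.mul_sum]
        _ = ∑ m ∈ D, ∑ 𝔠 : Fin nc, ∑ n ∈ D, conj (a m) * a n * ((1 / (4 * π) : ℂ) * ∫ t, FE m n 𝔠 t) :=
            Finset.sum_congr rfl fun m _ => Finset.sum_comm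
        _ = _ := Finset.sum_comm
    rw [hswap]
    exact Finset.sum_congr rfl fun 𝔠 _ => (hEis 𝔠).symm
  -- (4) real parts and positivity
  have hreM : HasSum (fun f => ((wM f : ℂ) * (((‖∑ n ∈ D, a n * P f n‖ ^ 2 : ℝ)) : ℂ)).re) VM.re :=
    Complex.hasSum_re hsumM
  have hreX : HasSum (fun f => ((wX f : ℂ) * (((‖∑ n ∈ D, a n * Pe f n‖ ^ 2 : ℝ)) : ℂ)).re) VX.re :=
    Complex.hasSum_re hsumX
  simp_rw [← Complex.ofReal_mul, Complex.ofReal_re] at hreM hreX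
  have hwM0 : ∀ f, 0 ≤ wM f := fun f => div_nonneg (hGauss_nonneg K _) (Real.cosh_pos _).le
  have hwX0 : ∀ f, 0 ≤ wX f := by
    intro f
    obtain ⟨h0, h4⟩ := hy f
    have hcos : 0 < Real.cos (π * y f) := Real.cos_pos_of_mem_Ioo ⟨by nlinarith, by nlinarith⟩
    exact div_nonneg (le_trans (by positivity) (hKexc_ge (K := K) h0 h4)) hcos.le
  have hFle : ∑ f ∈ F, wM f * ‖∑ n ∈ D, a n * P f n‖ ^ 2 ≤ VM.re := by
    exact sum_le_hasSum F (fun f _ => mul_nonneg (hwM0 f) (sq_nonneg _)) hreM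
  have hFele : ∑ f ∈ Fe, wX f * ‖∑ n ∈ D, a n * Pe f n‖ ^ 2 ≤ VX.re := by
    exact sum_le_hasSum Fe (fun f _ => mul_nonneg (hwX0 f) (sq_nonneg _)) hreX
  have hEre : (∑ 𝔠, (1 / (4 * π) : ℂ) * (((∫ t, g 𝔠 t : ℝ)) : ℂ)).re = ∑ 𝔠, 1 / (4 * π) * ∫ t, g 𝔠 t := by
    rw [Complex.re_sum]
    refine Finset.sum_congr rfl fun 𝔠 _ => ?_
    rw [show (1 / (4 * π) : ℂ) = ((1 / (4 * π) : ℝ) : ℂ) by push_cast; ring, ← Complex.ofReal_mul, Complex.ofReal_re]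
  have hRre : (((hZero K / (4 * π) : ℝ) : ℂ) * (l2 N a : ℂ) + ∑' c, Tc r K N a c).re ≤
      hZero K / (4 * π) * l2 N a + ∑' c, ‖Tc r K N a c‖ := by
    rw [Complex.add_re, ← Complex.ofReal_mul, Complex.ofReal_re]
    gcongr
    exact (Complex.re_le_norm _).trans (norm_tsum_le_tsum_norm hT)
  have hkey := congrArg Complex.re hidentity
  rw [Complex.add_re, Complex.add_re, hEre] at hkey
  refine ⟨hgint, ?_⟩
  calc ∑ f ∈ F, wM f * ‖∑ n ∈ D, a n * P f n‖ ^ 2 + ∑ f ∈ Fe, wX f * ‖∑ n ∈ D, a n * Pe f n‖ ^ 2 +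
        ∑ 𝔠, 1 / (4 * π) * ∫ t, g 𝔠 t
      ≤ VM.re + VX.re + ∑ 𝔠, 1 / (4 * π) * ∫ t, g 𝔠 t := by gcongr
    _ = (((hZero K / (4 * π) : ℝ) : ℂ) * (l2 N a : ℂ) + ∑' c, Tc r K N a c).re := hkey
    _ ≤ _ := hRre

/-! ### The dyadic shells in the spectral parameter ([DeshouillersIwaniec1982, p. 261: `K³ ↦ K²`]) -/

/-- The shell parameters `K_j = (T+1)/2^j`. [folklore] -/
def shellK (T : ℝ) (j : ℕ) : ℝ := (T + 1) / 2 ^ j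

/-- The number of shells `J = log₂ ⌊T+1⌋`. [folklore] -/
def shellJ (T : ℝ) : ℕ := Nat.log 2 ⌊T + 1⌋₊

/-- `0 < K_j`. [folklore] -/
theorem shellK_pos {T : ℝ} (hT : 0 ≤ T) (j : ℕ) : 0 < shellK T j := by unfold shellK; positivity

/-- `K_j ≥ 1` for `j ≤ J`. [folklore] -/
theorem one_le_shellK {T : ℝ} (hT : 0 ≤ T) {j : ℕ} (hj : j ≤ shellJ T) : 1 ≤ shellK T j := by
  rw [shellK, le_div_iff₀ (by positivity), one_mul]
  have h1 : (2 : ℝ) ^ j ≤ 2 ^ shellJ T := pow_le_pow_right₀ (by norm_num) hj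
  have h2 : (2 : ℝ) ^ shellJ T ≤ ⌊T + 1⌋₊ := by
    have hne : ⌊T + 1⌋₊ ≠ 0 := (Nat.floor_pos.2 (by linarith)).ne'
    exact_mod_cast Nat.pow_log_le_self 2 hne
  have h3 : (⌊T + 1⌋₊ : ℝ) ≤ T + 1 := Nat.floor_le (by linarith)
  linarith

/-- Every `|t| ≤ T` lies in a shell: `K_j/2 < |t| + 1 ≤ K_j` for some `j ≤ J`. [folklore] -/
theorem exists_shell {T t : ℝ} (hT : 0 ≤ T) (ht : |t| ≤ T) :
    ∃ j, j ≤ shellJ T ∧ shellK T j / 2 < |t| + 1 ∧ |t| + 1 ≤ shellK T j := by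
  set x : ℝ := |t| + 1 with hx
  have hx1 : 1 ≤ x := by rw [hx]; linarith [abs_nonneg t]
  have hx0 : 0 < x := by linarith
  have hxT : x ≤ T + 1 := by rw [hx]; linarith
  set ρ : ℝ := (T + 1) / x with hρ
  have hρ1 : 1 ≤ ρ := by rw [hρ, le_div_iff₀ hx0]; linarith
  have hρT : ρ ≤ T + 1 := by rw [hρ]; exact div_le_self (by linarith) hx1
  set n : ℕ := ⌊ρ⌋₊ with hn
  have hn1 : 1 ≤ n := (Nat.one_le_floor_iff ρ).2 hρ1
  have hnρ : (n : ℝ) ≤ ρ := Nat.floor_le (by linarith)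
  have hρn : ρ < n + 1 := Nat.lt_floor_add_one ρ
  set j : ℕ := Nat.log 2 n with hj
  have h2j : (2 : ℝ) ^ j ≤ n := by exact_mod_cast Nat.pow_log_le_self 2 (by omega : n ≠ 0)
  have hn2 : (n : ℝ) + 1 ≤ 2 ^ (j + 1) := by
    have := Nat.lt_pow_succ_log_self (b := 2) (by norm_num) n
    exact_mod_cast this
  have h2pos : (0 : ℝ) < 2 ^ j := by positivity
  refine ⟨j, ?_, ?_, ?_⟩
  · exact Nat.log_mono_right (Nat.floor_le_floor hρT)
  · rw [shellK, div_div, div_lt_iff₀ (by positivity)]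
    have : ρ < 2 ^ (j + 1) := lt_of_lt_of_le hρn hn2
    rw [hρ, div_lt_iff₀ hx0, pow_succ] at this
    linarith
  · rw [shellK, le_div_iff₀ h2pos]
    have : (2 : ℝ) ^ j ≤ ρ := h2j.trans hnρ
    rw [hρ, le_div_iff₀ hx0] at this
    linarith

/-- In its shell the weight is large: `h_{K_j}(t)/K_j ≥ 1/(4e)`. [folklore] -/
theorem hGauss_shell_ge {T t : ℝ} {j : ℕ} (h1 : shellK T j / 2 < |t| + 1) (h2 : |t| + 1 ≤ shellK T j) :
    1 / (4 * Real.exp 1) ≤ hGauss (shellK T j) t / shellK T j := by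
  set Kj := shellK T j with hKj
  have hK1 : 1 ≤ Kj := le_trans (by linarith [abs_nonneg t]) h2
  have hK0 : 0 < Kj := by linarith
  have ht : |t| ≤ Kj := by linarith
  have hge := hGauss_ge hK0 ht
  have hmax : (|t| + 1) / 2 ≤ max 1 (π * |t|) := by
    rcases le_or_gt |t| 1 with h | h
    · exact le_trans (by linarith) (le_max_left _ _)
    · refine le_trans ?_ (le_max_right _ _)
      nlinarith [Real.pi_gt_three, abs_nonneg t]
  rw [le_div_iff₀ hK0]
  have hexp : Real.exp (-1) = (Real.exp 1)⁻¹ := by rw [Real.exp_neg]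
  calc 1 / (4 * Real.exp 1) * Kj = (Real.exp 1)⁻¹ * (Kj / 4) := by ring
    _ ≤ (Real.exp 1)⁻¹ * ((|t| + 1) / 2) := mul_le_mul_of_nonneg_left (by linarith) (by positivity)
    _ ≤ Real.exp (-1) * max 1 (π * |t|) := by rw [hexp]; exact mul_le_mul_of_nonneg_left hmax (by positivity)
    _ ≤ hGauss Kj t := hge

/-- **The shell inequality**: for `|t| ≤ T`, `1 ≤ 4e Σ_{j ≤ J} h_{K_j}(t)/K_j`. [folklore] -/
theorem one_le_shellSum {T t : ℝ} (hT : 0 ≤ T) (ht : |t| ≤ T) :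
    1 ≤ 4 * Real.exp 1 * ∑ j ∈ Finset.range (shellJ T + 1), hGauss (shellK T j) t / shellK T j := by
  obtain ⟨j, hj, h1, h2⟩ := exists_shell hT ht
  have hterm := hGauss_shell_ge h1 h2
  have hnn : ∀ i ∈ Finset.range (shellJ T + 1), 0 ≤ hGauss (shellK T i) t / shellK T i := fun i _ =>
    div_nonneg (hGauss_nonneg _ _) (shellK_pos hT i).le
  have hsingle := Finset.single_le_sum hnn (Finset.mem_range.2 (Nat.lt_succ_of_le hj))
  have he : 0 < Real.exp 1 := Real.exp_pos 1
  calc (1 : ℝ) = 4 * Real.exp 1 * (1 / (4 * Real.exp 1)) := by field_simp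
    _ ≤ 4 * Real.exp 1 * (hGauss (shellK T j) t / shellK T j) := by gcongr
    _ ≤ _ := by gcongr

/-- `Σ_{j ≤ J} K_j² ≤ (4/3)(T+1)²`. [folklore] -/
theorem sum_shellK_sq_le (T : ℝ) (J : ℕ) : ∑ j ∈ Finset.range (J + 1), shellK T j ^ 2 ≤ 4 / 3 * (T + 1) ^ 2 := by
  have h : ∀ j, shellK T j ^ 2 = (T + 1) ^ 2 * (1 / 4 : ℝ) ^ j := by
    intro j
    rw [shellK, div_pow, ← pow_mul, one_div_pow, show (2 : ℝ) ^ (j * 2) = 4 ^ j by rw [mul_comm, pow_mul]; norm_num]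
    ring
  simp_rw [h, ← Finset.mul_sum]
  have hgeom : ∑ j ∈ Finset.range (J + 1), (1 / 4 : ℝ) ^ j ≤ 4 / 3 := by
    have hs := summable_geometric_of_lt_one (by norm_num : (0 : ℝ) ≤ 1 / 4) (by norm_num : (1 / 4 : ℝ) < 1)
    have h1 := hs.sum_le_tsum (Finset.range (J + 1)) (fun i _ => by positivity)
    rw [tsum_geometric_of_lt_one (by norm_num) (by norm_num)] at h1
    norm_num at h1 ⊢
    exact h1
  calc (T + 1) ^ 2 * ∑ j ∈ Finset.range (J + 1), (1 / 4 : ℝ) ^ j ≤ (T + 1) ^ 2 * (4 / 3) := by gcongr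
    _ = _ := by ring

/-- **The number of shells**: `J + 1 ≤ (1/(δ log 2) + 1)(T+1)^δ` for `0 < δ` (`log y ≤ (y^δ − 1)/δ`). [folklore] -/
theorem shellJ_add_one_le {T δ : ℝ} (hT : 0 ≤ T) (hδ : 0 < δ) :
    (shellJ T : ℝ) + 1 ≤ (1 / (δ * Real.log 2) + 1) * (T + 1) ^ δ := by
  have hT1 : 1 ≤ T + 1 := by linarith
  have hlog2 : 0 < Real.log 2 := Real.log_pos (by norm_num)
  -- `2^J ≤ T + 1`
  have hJ : (2 : ℝ) ^ shellJ T ≤ T + 1 := by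
    have hne : ⌊T + 1⌋₊ ≠ 0 := (Nat.floor_pos.2 hT1).ne'
    have h2 : (2 : ℝ) ^ shellJ T ≤ ⌊T + 1⌋₊ := by exact_mod_cast Nat.pow_log_le_self 2 hne
    exact h2.trans (Nat.floor_le (by linarith))
  -- `J log 2 ≤ log(T+1) ≤ ((T+1)^δ − 1)/δ`
  have h1 : (shellJ T : ℝ) * Real.log 2 ≤ Real.log (T + 1) := by
    rw [← Real.log_pow]
    exact Real.log_le_log (by positivity) hJ
  have h2 : Real.log (T + 1) ≤ ((T + 1) ^ δ - 1) / δ := by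
    rw [le_div_iff₀ hδ]
    have hT0 : (0 : ℝ) < T + 1 := by linarith
    have := Real.log_le_sub_one_of_pos (Real.rpow_pos_of_pos hT0 δ)
    rw [Real.log_rpow hT0] at this
    linarith
  have h3 : (1 : ℝ) ≤ (T + 1) ^ δ := Real.one_le_rpow hT1 hδ.le
  have hJle : (shellJ T : ℝ) ≤ (T + 1) ^ δ / (δ * Real.log 2) := by
    rw [le_div_iff₀ (by positivity)]
    calc (shellJ T : ℝ) * (δ * Real.log 2) = δ * ((shellJ T : ℝ) * Real.log 2) := by ring
      _ ≤ δ * (((T + 1) ^ δ - 1) / δ) := by gcongr; exact h1.trans h2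
      _ = (T + 1) ^ δ - 1 := by field_simp
      _ ≤ (T + 1) ^ δ := by linarith
  calc (shellJ T : ℝ) + 1 ≤ (T + 1) ^ δ / (δ * Real.log 2) + (T + 1) ^ δ := by linarith
    _ = _ := by ring

/-- `N^{e₁} ≤ 4 N^{e₂}` for `N ≥ 1/2`, `0 ≤ e₁ ≤ e₂ ≤ 2`. [folklore] -/
theorem rpow_le_four_mul_rpow {N e₁ e₂ : ℝ} (hN : 1 / 2 ≤ N) (he₁ : 0 ≤ e₁) (he : e₁ ≤ e₂) (he₂ : e₂ ≤ 2) :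
    N ^ e₁ ≤ 4 * N ^ e₂ := by
  have hN0 : 0 < N := by linarith
  rcases le_or_gt 1 N with h | h
  · calc N ^ e₁ ≤ N ^ e₂ := Real.rpow_le_rpow_of_exponent_le h he
      _ ≤ 4 * N ^ e₂ := by linarith [Real.rpow_nonneg hN0.le e₂]
  · have h1 : N ^ e₁ ≤ 1 := Real.rpow_le_one hN0.le h.le he₁
    have h2 : (1 / 4 : ℝ) ≤ N ^ e₂ := by
      calc (1 / 4 : ℝ) = (1 / 2 : ℝ) ^ (2 : ℝ) := by norm_num
        _ ≤ (1 / 2 : ℝ) ^ e₂ := Real.rpow_le_rpow_of_exponent_ge (by norm_num) (by norm_num) he₂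
        _ ≤ N ^ e₂ := Real.rpow_le_rpow (by norm_num) hN (by linarith)
    linarith

/-- **Young's inequality for the shell count**: `X^δ M ≤ X² + M^{2/(2−δ)}` (`X, M ≥ 0`, `0 < δ < 2`). [folklore] -/
theorem rpow_mul_le_young {X M δ : ℝ} (hX : 0 ≤ X) (hM : 0 ≤ M) (hδ : 0 < δ) (hδ2 : δ < 2) :
    X ^ δ * M ≤ X ^ 2 + M ^ (2 / (2 - δ)) := by
  have hp : (1 : ℝ) < 2 / δ := by rw [lt_div_iff₀ hδ]; linarith
  have hpq : (2 / δ).HolderConjugate (2 / (2 - δ)) := by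
    rw [Real.holderConjugate_iff]
    refine ⟨hp, ?_⟩
    field_simp
    ring
  have hy := Real.young_inequality_of_nonneg (Real.rpow_nonneg hX δ) hM hpq
  have h1 : (X ^ δ) ^ (2 / δ) = X ^ 2 := by
    rw [← Real.rpow_mul hX, show δ * (2 / δ) = ((2 : ℕ) : ℝ) by field_simp; norm_num, Real.rpow_natCast]
  rw [h1] at hy
  have hq1 : 1 ≤ 2 / (2 - δ) := by rw [le_div_iff₀ (by linarith)]; linarith
  have hA : X ^ 2 / (2 / δ) ≤ X ^ 2 := div_le_self (by positivity) hp.le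
  have hB : M ^ (2 / (2 - δ)) / (2 / (2 - δ)) ≤ M ^ (2 / (2 - δ)) := div_le_self (Real.rpow_nonneg hM _) hq1
  linarith

/-! ### The three large sieve bounds from the shells -/

/-- `h₀(K)/(4πK) = K²/(8√π)`. [folklore] -/
theorem hZero_div (K : ℝ) (hK : 0 < K) : hZero K / (4 * π) / K = K ^ 2 / (8 * Real.sqrt π) := by
  have hπ := Real.pi_pos
  have hsq : Real.sqrt π * Real.sqrt π = π := Real.mul_self_sqrt hπ.le
  have hs0 : 0 < Real.sqrt π := Real.sqrt_pos.2 hπ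
  rw [hZero]
  field_simp
  nlinarith [hsq]

/-- `h_K` is measurable. [folklore] -/
theorem measurable_hGauss (K : ℝ) : Measurable (hGauss K) := by
  unfold hGauss
  refine Measurable.mul (Measurable.ite ?_ measurable_const ?_) (by fun_prop)
  · exact measurableSet_eq_fun measurable_id measurable_const
  · exact ((by fun_prop : Continuous fun t : ℝ => π * t * Real.cosh (π * t)).measurable).div
      ((by fun_prop : Continuous fun t : ℝ => Real.sinh (π * t)).measurable)

/-- `h_K(t) > 0`. [folklore] -/
theorem hGauss_pos (K t : ℝ) : 0 < hGauss K t := by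
  by_cases ht : t = 0
  · subst ht; rw [hGauss, if_pos rfl]; positivity
  · refine lt_of_lt_of_le ?_ (hGauss_ge_of_ne (K := K) ht)
    positivity

/-- **The Maass cusp forms in `|t_f| ≤ T`, shell by shell**:
`Σ_{f∈F} |Σ a P f|²/ch(πt_f) ≤ 4e Σ_{j≤J} (K_j²/(8√π) + C N^{1+6ε}/r) ‖a‖²`.
[cite: DeshouillersIwaniec1982, §5.3 p. 261] -/
theorem maass_shells_le {ι : Type*} {tf : ι → ℝ} {P : ι → ℕ → ℂ} {ιe : Type*} {y : ιe → ℝ} {Pe : ιe → ℕ → ℂ}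
    {nc : ℕ} {PE : Fin nc → ℝ → ℕ → ℂ} {r : ℕ} (hfam : KuzGaussFamily ι tf P ιe y Pe nc PE r)
    {ε C : ℝ} (hC : ∀ (K N : ℝ) (a : ℕ → ℂ), 1 ≤ K → 1 / 2 ≤ N →
      Summable (fun c => ‖Tc r K N a c‖) ∧ ∑' c, ‖Tc r K N a c‖ ≤ C * K * N ^ (1 + 6 * ε) / r * l2 N a)
    {T N : ℝ} (hT : 1 ≤ T) (hN : 1 / 2 ≤ N) (a : ℕ → ℂ) (F : Finset ι) (hF : ∀ f ∈ F, |tf f| ≤ T) :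
    ∑ f ∈ F, ‖∑ n ∈ dyadic N, a n * P f n‖ ^ 2 / Real.cosh (π * tf f) ≤
      4 * Real.exp 1 * ∑ j ∈ Finset.range (shellJ T + 1), (shellK T j ^ 2 / (8 * Real.sqrt π) + C * N ^ (1 + 6 * ε) / r) * l2 N a := by
  have hT0 : 0 ≤ T := by linarith
  have hN0 : 0 ≤ N := by linarith
  set S : ι → ℝ := fun f => ‖∑ n ∈ dyadic N, a n * P f n‖ ^ 2 with hS
  -- per shell: the weighted sum is bounded by `specSide_le`
  have hshell : ∀ j ∈ Finset.range (shellJ T + 1),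
      ∑ f ∈ F, hGauss (shellK T j) (tf f) / Real.cosh (π * tf f) * S f ≤
        hZero (shellK T j) / (4 * π) * l2 N a + C * shellK T j * N ^ (1 + 6 * ε) / r * l2 N a := by
    intro j hj
    have hK1 : 1 ≤ shellK T j := one_le_shellK hT0 (Nat.lt_succ_iff.1 (Finset.mem_range.1 hj))
    obtain ⟨hsum, hTle⟩ := hC (shellK T j) N a hK1 hN
    obtain ⟨hgint, hspec⟩ := specSide_le hfam hK1 hN0 a hsum F ∅
    rw [Finset.sum_empty, add_zero] at hspec
    have hEis : 0 ≤ ∑ 𝔠, 1 / (4 * π) * ∫ t, hGauss (shellK T j) t / Real.cosh (π * t) * ‖∑ n ∈ dyadic N, a n * PE 𝔠 t n‖ ^ 2 :=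
      Finset.sum_nonneg fun 𝔠 _ => mul_nonneg (by positivity) (integral_nonneg fun t =>
        mul_nonneg (div_nonneg (hGauss_nonneg _ _) (Real.cosh_pos _).le) (sq_nonneg _))
    linarith
  -- pointwise shell inequality, summed
  calc ∑ f ∈ F, S f / Real.cosh (π * tf f)
      ≤ ∑ f ∈ F, (4 * Real.exp 1 * ∑ j ∈ Finset.range (shellJ T + 1), hGauss (shellK T j) (tf f) / shellK T j) *
          (S f / Real.cosh (π * tf f)) := by
        refine Finset.sum_le_sum fun f hf => ?_
        exact le_mul_of_one_le_left (div_nonneg (sq_nonneg _) (Real.cosh_pos _).le) (one_le_shellSum hT0 (hF f hf))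
    _ = 4 * Real.exp 1 * ∑ j ∈ Finset.range (shellJ T + 1), (shellK T j)⁻¹ *
          ∑ f ∈ F, hGauss (shellK T j) (tf f) / Real.cosh (π * tf f) * S f := by
        rw [Finset.mul_sum]
        simp_rw [Finset.mul_sum, Finset.sum_mul]
        rw [Finset.sum_comm]
        refine Finset.sum_congr rfl fun f _ => Finset.sum_congr rfl fun j _ => ?_
        field_simp
    _ ≤ 4 * Real.exp 1 * ∑ j ∈ Finset.range (shellJ T + 1), (shellK T j)⁻¹ *
          (hZero (shellK T j) / (4 * π) * l2 N a + C * shellK T j * N ^ (1 + 6 * ε) / r * l2 N a) := by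
        gcongr with j hj
        · exact inv_nonneg.2 (shellK_pos hT0 j).le
        · exact hshell j hj
    _ = _ := by
        congr 1
        refine Finset.sum_congr rfl fun j _ => ?_
        have hKp := shellK_pos hT0 j
        have h := hZero_div (shellK T j) hKp
        set X : ℝ := C * N ^ (1 + 6 * ε) / (r : ℝ) with hX
        have h1 : C * shellK T j * N ^ (1 + 6 * ε) / ↑r * l2 N a = shellK T j * X * l2 N a := by rw [hX]; ring
        rw [h1, ← h]
        field_simp

/-- **The exceptional spectrum** (test function `h_1`, `h_1(iy) ≥ √2/2`):
`Σ_{f∈Fe} |Σ a Pe f|²/cos(πy_f) ≤ √2 (1/(8√π) + C N^{1+6ε}/r) ‖a‖²`. [cite: DeshouillersIwaniec1982, §5.3 p. 261] -/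
theorem exc_le {ι : Type*} {tf : ι → ℝ} {P : ι → ℕ → ℂ} {ιe : Type*} {y : ιe → ℝ} {Pe : ιe → ℕ → ℂ}
    {nc : ℕ} {PE : Fin nc → ℝ → ℕ → ℂ} {r : ℕ} (hfam : KuzGaussFamily ι tf P ιe y Pe nc PE r)
    {ε C : ℝ} (hC : ∀ (K N : ℝ) (a : ℕ → ℂ), 1 ≤ K → 1 / 2 ≤ N →
      Summable (fun c => ‖Tc r K N a c‖) ∧ ∑' c, ‖Tc r K N a c‖ ≤ C * K * N ^ (1 + 6 * ε) / r * l2 N a)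
    {N : ℝ} (hN : 1 / 2 ≤ N) (a : ℕ → ℂ) (Fe : Finset ιe) :
    ∑ f ∈ Fe, ‖∑ n ∈ dyadic N, a n * Pe f n‖ ^ 2 / Real.cos (π * y f) ≤
      Real.sqrt 2 * (1 / (8 * Real.sqrt π) + C * N ^ (1 + 6 * ε) / r) * l2 N a := by
  have hN0 : 0 ≤ N := by linarith
  have hy := hfam.1
  obtain ⟨hsum, hTle⟩ := hC 1 N a le_rfl hN
  obtain ⟨hgint, hspec⟩ := specSide_le hfam le_rfl hN0 a hsum ∅ Fe
  rw [Finset.sum_empty, zero_add] at hspec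
  have hEis : 0 ≤ ∑ 𝔠, 1 / (4 * π) * ∫ t, hGauss 1 t / Real.cosh (π * t) * ‖∑ n ∈ dyadic N, a n * PE 𝔠 t n‖ ^ 2 :=
    Finset.sum_nonneg fun 𝔠 _ => mul_nonneg (by positivity) (integral_nonneg fun t =>
      mul_nonneg (div_nonneg (hGauss_nonneg _ _) (Real.cosh_pos _).le) (sq_nonneg _))
  have hX : ∑ f ∈ Fe, hGaussExc 1 (y f) / Real.cos (π * y f) * ‖∑ n ∈ dyadic N, a n * Pe f n‖ ^ 2 ≤
      hZero 1 / (4 * π) * l2 N a + C * 1 * N ^ (1 + 6 * ε) / r * l2 N a := by linarith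
  have hs2 : 0 < Real.sqrt 2 := Real.sqrt_pos.2 (by norm_num)
  have hsq2 : Real.sqrt 2 * Real.sqrt 2 = 2 := Real.mul_self_sqrt (by norm_num)
  -- pointwise: `1/cos ≤ √2 · hGaussExc 1 (y f)/cos`
  have hpt : ∀ f ∈ Fe, ‖∑ n ∈ dyadic N, a n * Pe f n‖ ^ 2 / Real.cos (π * y f) ≤
      Real.sqrt 2 * (hGaussExc 1 (y f) / Real.cos (π * y f) * ‖∑ n ∈ dyadic N, a n * Pe f n‖ ^ 2) := by
    intro f _
    obtain ⟨h0, h4⟩ := hy f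
    have hcos : 0 < Real.cos (π * y f) := Real.cos_pos_of_mem_Ioo ⟨by nlinarith [Real.pi_pos], by nlinarith [Real.pi_pos]⟩
    have hge := hKexc_ge (K := 1) h0 h4
    have h1 : 1 ≤ Real.sqrt 2 * hGaussExc 1 (y f) := by nlinarith
    calc ‖∑ n ∈ dyadic N, a n * Pe f n‖ ^ 2 / Real.cos (π * y f)
        = 1 * (‖∑ n ∈ dyadic N, a n * Pe f n‖ ^ 2 / Real.cos (π * y f)) := (one_mul _).symm
      _ ≤ (Real.sqrt 2 * hGaussExc 1 (y f)) * (‖∑ n ∈ dyadic N, a n * Pe f n‖ ^ 2 / Real.cos (π * y f)) :=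
          mul_le_mul_of_nonneg_right h1 (div_nonneg (sq_nonneg _) hcos.le)
      _ = _ := by field_simp
  have hZ1 : hZero 1 / (4 * π) = 1 / (8 * Real.sqrt π) := by
    have := hZero_div 1 one_pos; simpa using this
  calc ∑ f ∈ Fe, ‖∑ n ∈ dyadic N, a n * Pe f n‖ ^ 2 / Real.cos (π * y f)
      ≤ ∑ f ∈ Fe, Real.sqrt 2 * (hGaussExc 1 (y f) / Real.cos (π * y f) * ‖∑ n ∈ dyadic N, a n * Pe f n‖ ^ 2) :=
        Finset.sum_le_sum hpt
    _ = Real.sqrt 2 * ∑ f ∈ Fe, hGaussExc 1 (y f) / Real.cos (π * y f) * ‖∑ n ∈ dyadic N, a n * Pe f n‖ ^ 2 := by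
        rw [Finset.mul_sum]
    _ ≤ Real.sqrt 2 * (hZero 1 / (4 * π) * l2 N a + C * 1 * N ^ (1 + 6 * ε) / r * l2 N a) := by gcongr
    _ = _ := by rw [hZ1]; ring

/-- **The Eisenstein spectrum on `|t| ≤ T`, shell by shell**: the integrand
`Σ_𝔠 |Σ a PE 𝔠 t|²/ch(πt)` is integrable on `[−T, T]` and
`∫_{−T}^{T} Σ_𝔠 |Σ a PE|²/ch ≤ 16πe Σ_{j≤J} (K_j²/(8√π) + C N^{1+6ε}/r) ‖a‖²`.
[cite: DeshouillersIwaniec1982, §5.3 p. 261] -/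
theorem eis_shells_le {ι : Type*} {tf : ι → ℝ} {P : ι → ℕ → ℂ} {ιe : Type*} {y : ιe → ℝ} {Pe : ιe → ℕ → ℂ}
    {nc : ℕ} {PE : Fin nc → ℝ → ℕ → ℂ} {r : ℕ} (hfam : KuzGaussFamily ι tf P ιe y Pe nc PE r)
    {ε C : ℝ} (hC : ∀ (K N : ℝ) (a : ℕ → ℂ), 1 ≤ K → 1 / 2 ≤ N →
      Summable (fun c => ‖Tc r K N a c‖) ∧ ∑' c, ‖Tc r K N a c‖ ≤ C * K * N ^ (1 + 6 * ε) / r * l2 N a)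
    {T N : ℝ} (hT : 1 ≤ T) (hN : 1 / 2 ≤ N) (a : ℕ → ℂ) :
    IntegrableOn (fun t => ∑ 𝔠, ‖∑ n ∈ dyadic N, a n * PE 𝔠 t n‖ ^ 2 / Real.cosh (π * t)) (Set.Icc (-T) T) ∧
    ∫ t in Set.Icc (-T) T, ∑ 𝔠, ‖∑ n ∈ dyadic N, a n * PE 𝔠 t n‖ ^ 2 / Real.cosh (π * t) ≤
      16 * π * Real.exp 1 * ∑ j ∈ Finset.range (shellJ T + 1), (shellK T j ^ 2 / (8 * Real.sqrt π) + C * N ^ (1 + 6 * ε) / r) * l2 N a := by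
  have hT0 : 0 ≤ T := by linarith
  have hN0 : 0 ≤ N := by linarith
  have hπ := Real.pi_pos
  set SE : Fin nc → ℝ → ℝ := fun 𝔠 t => ‖∑ n ∈ dyadic N, a n * PE 𝔠 t n‖ ^ 2 with hSE
  set G : ℝ → ℝ := fun t => ∑ 𝔠, SE 𝔠 t / Real.cosh (π * t) with hG
  set g : ℕ → Fin nc → ℝ → ℝ := fun j 𝔠 t => hGauss (shellK T j) t / Real.cosh (π * t) * SE 𝔠 t with hg
  -- per shell: integrability and the bound from `specSide_le`
  have hshell : ∀ j ∈ Finset.range (shellJ T + 1), (∀ 𝔠, Integrable (g j 𝔠)) ∧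
      ∑ 𝔠, 1 / (4 * π) * ∫ t, g j 𝔠 t ≤ hZero (shellK T j) / (4 * π) * l2 N a + C * shellK T j * N ^ (1 + 6 * ε) / r * l2 N a := by
    intro j hj
    have hK1 : 1 ≤ shellK T j := one_le_shellK hT0 (Nat.lt_succ_iff.1 (Finset.mem_range.1 hj))
    obtain ⟨hsum, hTle⟩ := hC (shellK T j) N a hK1 hN
    obtain ⟨hgint, hspec⟩ := specSide_le hfam hK1 hN0 a hsum ∅ ∅
    rw [Finset.sum_empty, Finset.sum_empty, zero_add, zero_add] at hspec
    exact ⟨hgint, hspec.trans (by linarith)⟩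
  have hg0 : ∀ j 𝔠 t, 0 ≤ g j 𝔠 t := fun j 𝔠 t =>
    mul_nonneg (div_nonneg (hGauss_nonneg _ _) (Real.cosh_pos _).le) (sq_nonneg _)
  -- the dominating function on `[−T, T]`
  set H : ℝ → ℝ := fun t => 4 * Real.exp 1 * ∑ j ∈ Finset.range (shellJ T + 1), (shellK T j)⁻¹ * ∑ 𝔠, g j 𝔠 t with hH
  have hHint : Integrable H := by
    refine Integrable.const_mul (integrable_finsetSum _ fun j hj => Integrable.const_mul (integrable_finsetSum _ fun 𝔠 _ => ?_) _) _
    exact (hshell j hj).1 𝔠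
  have hH0 : ∀ t, 0 ≤ H t := fun t => mul_nonneg (by positivity) (Finset.sum_nonneg fun j _ =>
    mul_nonneg (inv_nonneg.2 (shellK_pos hT0 j).le) (Finset.sum_nonneg fun 𝔠 _ => hg0 j 𝔠 t))
  -- pointwise on `[−T, T]`: `G ≤ H`
  have hGH : ∀ t ∈ Set.Icc (-T) T, G t ≤ H t := by
    intro t ht
    have habs : |t| ≤ T := abs_le.2 ⟨ht.1, ht.2⟩
    have h1 := one_le_shellSum hT0 habs
    have hGnn : 0 ≤ G t := Finset.sum_nonneg fun 𝔠 _ => div_nonneg (sq_nonneg _) (Real.cosh_pos _).le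
    calc G t = 1 * G t := (one_mul _).symm
      _ ≤ (4 * Real.exp 1 * ∑ j ∈ Finset.range (shellJ T + 1), hGauss (shellK T j) t / shellK T j) * G t :=
          mul_le_mul_of_nonneg_right h1 hGnn
      _ = H t := by
          simp only [hH, hG, hg]
          rw [mul_assoc, Finset.sum_mul]
          congr 1
          refine Finset.sum_congr rfl fun j _ => ?_
          rw [Finset.mul_sum, Finset.mul_sum]
          refine Finset.sum_congr rfl fun 𝔠 _ => ?_
          have := (shellK_pos hT0 j).ne'
          field_simp
  -- measurability of `G`
  have hGmeas : AEStronglyMeasurable G (volume.restrict (Set.Icc (-T) T)) := by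
    -- `G = (Σ_𝔠 g 0 𝔠) / hGauss K₀`
    have hK0 : (0 : ℕ) ∈ Finset.range (shellJ T + 1) := Finset.mem_range.2 (Nat.succ_pos _)
    have hsumint : Integrable fun t => ∑ 𝔠, g 0 𝔠 t := integrable_finsetSum _ fun 𝔠 _ => (hshell 0 hK0).1 𝔠
    have hquot : AEStronglyMeasurable (fun t => (∑ 𝔠, g 0 𝔠 t) * (hGauss (shellK T 0) t)⁻¹) volume :=
      hsumint.aestronglyMeasurable.mul ((measurable_hGauss _).inv.aestronglyMeasurable)
    refine (hquot.congr (Eventually.of_forall fun t => ?_)).restrict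
    have hpos := hGauss_pos (shellK T 0) t
    simp only [hG, hg, Finset.sum_mul]
    refine Finset.sum_congr rfl fun 𝔠 _ => ?_
    field_simp
  have hGint : IntegrableOn G (Set.Icc (-T) T) := by
    refine Integrable.mono' hHint.integrableOn hGmeas ?_
    refine (ae_restrict_iff' measurableSet_Icc).2 (Eventually.of_forall fun t ht => ?_)
    rw [Real.norm_of_nonneg (Finset.sum_nonneg fun 𝔠 _ => div_nonneg (sq_nonneg _) (Real.cosh_pos _).le)]
    exact hGH t ht
  refine ⟨hGint, ?_⟩
  -- integrate
  have hIH : ∫ t, H t = 4 * Real.exp 1 * ∑ j ∈ Finset.range (shellJ T + 1), (shellK T j)⁻¹ * ∑ 𝔠, ∫ t, g j 𝔠 t := by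
    simp only [hH]
    rw [integral_const_mul, integral_finsetSum _ fun j hj => Integrable.const_mul (integrable_finsetSum _ fun 𝔠 _ => (hshell j hj).1 𝔠) _]
    congr 1
    refine Finset.sum_congr rfl fun j hj => ?_
    rw [integral_const_mul, integral_finsetSum _ fun 𝔠 _ => (hshell j hj).1 𝔠]
  calc ∫ t in Set.Icc (-T) T, G t ≤ ∫ t in Set.Icc (-T) T, H t :=
        setIntegral_mono_on hGint hHint.integrableOn measurableSet_Icc hGH
    _ ≤ ∫ t, H t := setIntegral_le_integral hHint (Eventually.of_forall hH0)
    _ = 4 * Real.exp 1 * ∑ j ∈ Finset.range (shellJ T + 1), (shellK T j)⁻¹ * ∑ 𝔠, ∫ t, g j 𝔠 t := hIH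
    _ = 4 * Real.exp 1 * ∑ j ∈ Finset.range (shellJ T + 1), (shellK T j)⁻¹ * (4 * π) * ∑ 𝔠, 1 / (4 * π) * ∫ t, g j 𝔠 t := by
        congr 1
        refine Finset.sum_congr rfl fun j _ => ?_
        rw [Finset.mul_sum, Finset.mul_sum]
        refine Finset.sum_congr rfl fun 𝔠 _ => ?_
        field_simp
    _ ≤ 4 * Real.exp 1 * ∑ j ∈ Finset.range (shellJ T + 1), (shellK T j)⁻¹ * (4 * π) *
          (hZero (shellK T j) / (4 * π) * l2 N a + C * shellK T j * N ^ (1 + 6 * ε) / r * l2 N a) := by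
        gcongr with j hj
        · exact mul_nonneg (inv_nonneg.2 (shellK_pos hT0 j).le) (by positivity)
        · exact (hshell j hj).2
    _ = _ := by
        rw [show 16 * π * Real.exp 1 = 4 * Real.exp 1 * (4 * π) by ring, mul_assoc (4 * Real.exp 1) (4 * π)]
        congr 1
        rw [Finset.mul_sum]
        refine Finset.sum_congr rfl fun j _ => ?_
        have hKp := shellK_pos hT0 j
        have h := hZero_div (shellK T j) hKp
        set X : ℝ := C * N ^ (1 + 6 * ε) / (r : ℝ) with hX
        have h1 : C * shellK T j * N ^ (1 + 6 * ε) / ↑r * l2 N a = shellK T j * X * l2 N a := by rw [hX]; ring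
        rw [h1, ← h]
        field_simp

/-- The sum over the shells of the per-shell bound: for `ε ≤ 1/12`, `12ε ≤ ε'`, `C ≥ 0`,
`Σ_{j≤J} (K_j²/(8√π) + C N^{1+6ε}/r) ≤ (1 + 8 C_δ C)(T² + N^{1+ε'}/r)`, `C_δ = 1/(6ε log 2) + 1`. [folklore] -/
theorem shellSum_le {ε ε' C : ℝ} (hε : 0 < ε) (hε1 : ε ≤ 1 / 12) (hεε' : 12 * ε ≤ ε') (hC0 : 0 ≤ C)
    {T N : ℝ} (hT : 1 ≤ T) (hN : 1 / 2 ≤ N) {r : ℕ} (hr : 1 ≤ r) :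
    ∑ j ∈ Finset.range (shellJ T + 1), (shellK T j ^ 2 / (8 * Real.sqrt π) + C * N ^ (1 + 6 * ε) / r) ≤
      (1 + 8 * (1 / (6 * ε * Real.log 2) + 1) * C) * (T ^ 2 + N ^ (1 + ε') / r) := by
  have hT0 : 0 ≤ T := by linarith
  have hN0 : 0 < N := by linarith
  have hr0 : (0 : ℝ) < r := by exact_mod_cast hr
  have hr1 : (1 : ℝ) ≤ r := by exact_mod_cast hr
  have hπ := Real.pi_pos
  have hsπ : 1 ≤ Real.sqrt π := by
    rw [show (1 : ℝ) = Real.sqrt 1 by simp]; exact Real.sqrt_le_sqrt (by linarith [Real.pi_gt_three])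
  have hδ0 : 0 < 6 * ε := by positivity
  have hδ2 : 6 * ε < 2 := by linarith
  have hlog2 : 0 < Real.log 2 := Real.log_pos (by norm_num)
  set Cδ : ℝ := 1 / (6 * ε * Real.log 2) + 1 with hCδ
  have hCδ0 : 0 ≤ Cδ := by positivity
  rw [Finset.sum_add_distrib, Finset.sum_const, Finset.card_range, nsmul_eq_mul, ← Finset.sum_div]
  -- the `K_j²` part
  have h1 : (∑ j ∈ Finset.range (shellJ T + 1), shellK T j ^ 2) / (8 * Real.sqrt π) ≤ T ^ 2 := by
    rw [div_le_iff₀ (by positivity)]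
    have := sum_shellK_sq_le T (shellJ T)
    nlinarith
  -- the shell count times `N^{1+6ε}/r`
  have hJ := shellJ_add_one_le hT0 hδ0
  push_cast at hJ ⊢
  have hW : N ^ (1 + 12 * ε) / r ≤ T ^ 2 + N ^ (1 + ε') / r := by
    rcases le_or_gt 1 N with h | h
    · have : N ^ (1 + 12 * ε) ≤ N ^ (1 + ε') := Real.rpow_le_rpow_of_exponent_le h (by linarith)
      have : N ^ (1 + 12 * ε) / r ≤ N ^ (1 + ε') / r := div_le_div_of_nonneg_right this hr0.le
      linarith [sq_nonneg T]
    · have h2 : N ^ (1 + 12 * ε) ≤ 1 := Real.rpow_le_one hN0.le h.le (by linarith)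
      have h3 : N ^ (1 + 12 * ε) / r ≤ 1 := by rw [div_le_one hr0]; linarith
      have h4 : 0 ≤ N ^ (1 + ε') / r := by positivity
      nlinarith
  have hY : (T + 1) ^ (6 * ε) * N ^ (1 + 6 * ε) ≤ 4 * T ^ 2 + 4 * N ^ (1 + 12 * ε) := by
    have hmono : (T + 1) ^ (6 * ε) ≤ (2 * T) ^ (6 * ε) := Real.rpow_le_rpow (by linarith) (by linarith) hδ0.le
    have hyoung := rpow_mul_le_young (by linarith : (0 : ℝ) ≤ 2 * T) (Real.rpow_nonneg hN0.le (1 + 6 * ε)) hδ0 hδ2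
    have he : (N ^ (1 + 6 * ε)) ^ (2 / (2 - 6 * ε)) = N ^ ((1 + 6 * ε) * (2 / (2 - 6 * ε))) := by rw [← Real.rpow_mul hN0.le]
    have hexp1 : 0 ≤ (1 + 6 * ε) * (2 / (2 - 6 * ε)) := by
      have : 0 < 2 - 6 * ε := by linarith
      positivity
    have hexp2 : (1 + 6 * ε) * (2 / (2 - 6 * ε)) ≤ 1 + 12 * ε := by
      have h2δ : 0 < 2 - 6 * ε := by linarith
      rw [← mul_div_assoc, div_le_iff₀ h2δ]
      nlinarith [mul_nonneg hε.le (by linarith : (0 : ℝ) ≤ 1 - 12 * ε)]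
    have h4 := rpow_le_four_mul_rpow hN hexp1 hexp2 (by linarith)
    calc (T + 1) ^ (6 * ε) * N ^ (1 + 6 * ε) ≤ (2 * T) ^ (6 * ε) * N ^ (1 + 6 * ε) := by gcongr
      _ ≤ (2 * T) ^ 2 + (N ^ (1 + 6 * ε)) ^ (2 / (2 - 6 * ε)) := hyoung
      _ = 4 * T ^ 2 + N ^ ((1 + 6 * ε) * (2 / (2 - 6 * ε))) := by rw [he]; ring
      _ ≤ 4 * T ^ 2 + 4 * N ^ (1 + 12 * ε) := by linarith
  have hCC : 0 ≤ Cδ * C := mul_nonneg hCδ0 hC0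
  have h3 : 0 ≤ N ^ (1 + ε') / r := by positivity
  have h2 : (shellJ T + 1 : ℝ) * (C * N ^ (1 + 6 * ε)) / r ≤ 8 * Cδ * C * (T ^ 2 + N ^ (1 + ε') / r) := by
    have hNpow : 0 ≤ N ^ (1 + 6 * ε) := Real.rpow_nonneg hN0.le _
    calc (shellJ T + 1 : ℝ) * (C * N ^ (1 + 6 * ε)) / r ≤ Cδ * (T + 1) ^ (6 * ε) * (C * N ^ (1 + 6 * ε)) / r := by
          gcongr
      _ = Cδ * C * ((T + 1) ^ (6 * ε) * N ^ (1 + 6 * ε)) / r := by ring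
      _ ≤ Cδ * C * (4 * T ^ 2 + 4 * N ^ (1 + 12 * ε)) / r := by gcongr
      _ = 4 * (Cδ * C) * (T ^ 2 / r + N ^ (1 + 12 * ε) / r) := by field_simp
      _ ≤ 4 * (Cδ * C) * (T ^ 2 + (T ^ 2 + N ^ (1 + ε') / r)) := by
          gcongr
          · exact div_le_self (sq_nonneg T) hr1
      _ ≤ 8 * Cδ * C * (T ^ 2 + N ^ (1 + ε') / r) := by nlinarith [mul_nonneg hCC h3]
  have hsum0 : 0 ≤ (∑ j ∈ Finset.range (shellJ T + 1), shellK T j ^ 2) / (8 * Real.sqrt π) := by positivity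
  calc (∑ j ∈ Finset.range (shellJ T + 1), shellK T j ^ 2) / (8 * Real.sqrt π) + (shellJ T + 1 : ℝ) * (C * N ^ (1 + 6 * ε) / r)
      = (∑ j ∈ Finset.range (shellJ T + 1), shellK T j ^ 2) / (8 * Real.sqrt π) + (shellJ T + 1 : ℝ) * (C * N ^ (1 + 6 * ε)) / r := by ring
    _ ≤ T ^ 2 + 8 * Cδ * C * (T ^ 2 + N ^ (1 + ε') / r) := add_le_add h1 h2
    _ ≤ _ := by nlinarith [mul_nonneg hCC h3, sq_nonneg T]

set_option maxHeartbeats 800000 in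
/-- **Large sieve inequalities for the Maass and Eisenstein coefficients**
[DeshouillersIwaniec1982, Theorem 2 (1.29)–(1.30)] for an abstract `KuzGaussFamily` at level `r`:
for every `ε' > 0` there is `K(ε')` such that for `T ≥ 1`, `N ≥ 1/2` and all finite sets of forms
`F` (with `|t_f| ≤ T`), `Fe`:
`Σ_{f∈F} |Σ a P f|²/ch(πt_f) + Σ_{f∈Fe} |Σ a Pe f|²/cos(πy_f) ≤ K (T² + N^{1+ε'}/r) ‖a‖²` and
`∫_{−T}^{T} Σ_𝔠 |Σ a PE 𝔠 t|²/ch(πt) dt ≤ K (T² + N^{1+ε'}/r) ‖a‖²` (the integrand being integrable).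
Proof: [DeshouillersIwaniec1982, §5.3] with the inputs of this file (`specSide_le`,
`kloostermanSide_le`, Proposition 3 via `norm_quadB_le_short`) and dyadic shells in `|t|`.
[cite: DeshouillersIwaniec1982, Theorem 2 (1.29)–(1.30), §5.3 pp. 260–261] -/
theorem largeSieve_maass_eis {ε' : ℝ} (hε' : 0 < ε') :
    ∃ Kc : ℝ, 0 ≤ Kc ∧ ∀ (ι : Type*) (tf : ι → ℝ) (P : ι → ℕ → ℂ) (ιe : Type*) (y : ιe → ℝ) (Pe : ιe → ℕ → ℂ)
      (nc : ℕ) (PE : Fin nc → ℝ → ℕ → ℂ) (r : ℕ), 1 ≤ r → KuzGaussFamily ι tf P ιe y Pe nc PE r →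
      ∀ (T N : ℝ), 1 ≤ T → 1 / 2 ≤ N → ∀ a : ℕ → ℂ,
        (∀ (F : Finset ι) (Fe : Finset ιe), (∀ f ∈ F, |tf f| ≤ T) →
          ∑ f ∈ F, ‖∑ n ∈ dyadic N, a n * P f n‖ ^ 2 / Real.cosh (π * tf f) +
            ∑ f ∈ Fe, ‖∑ n ∈ dyadic N, a n * Pe f n‖ ^ 2 / Real.cos (π * y f) ≤
            Kc * (T ^ 2 + N ^ (1 + ε') / r) * l2 N a) ∧
        (IntegrableOn (fun t => ∑ 𝔠, ‖∑ n ∈ dyadic N, a n * PE 𝔠 t n‖ ^ 2 / Real.cosh (π * t)) (Set.Icc (-T) T) ∧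
          ∫ t in Set.Icc (-T) T, ∑ 𝔠, ‖∑ n ∈ dyadic N, a n * PE 𝔠 t n‖ ^ 2 / Real.cosh (π * t) ≤
            Kc * (T ^ 2 + N ^ (1 + ε') / r) * l2 N a) := by
  -- the auxiliary exponent
  set ε : ℝ := min ε' 1 / 24 with hεdef
  have hε : 0 < ε := by rw [hεdef]; positivity
  have hε1 : ε ≤ 1 / 12 := by
    rw [hεdef]; have := min_le_right ε' 1; linarith
  have hεε' : 12 * ε ≤ ε' := by
    rw [hεdef]; have := min_le_left ε' 1; linarith
  obtain ⟨A, hA0, hA⟩ := norm_quadB_le_short hε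
  obtain ⟨C, hC0, hC⟩ := kloostermanSide_le hε hε1 hA0 hA
  have hlog2 : 0 < Real.log 2 := Real.log_pos (by norm_num)
  set Cδ : ℝ := 1 / (6 * ε * Real.log 2) + 1 with hCδ
  have hCδ0 : 0 ≤ Cδ := by positivity
  set B : ℝ := 1 + 8 * Cδ * C with hB
  have hB0 : 0 ≤ B := by positivity
  refine ⟨16 * π * Real.exp 1 * B + 2 * (1 + 4 * C), by positivity, ?_⟩
  intro ι tf P ιe y Pe nc PE r hr hfam T N hT hN a
  have hπ := Real.pi_pos
  have he1 : 1 ≤ Real.exp 1 := Real.one_le_exp (by norm_num)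
  have hN0 : 0 < N := by linarith
  have hr0 : (0 : ℝ) < r := by exact_mod_cast hr
  have hl2 : 0 ≤ l2 N a := by unfold l2; positivity
  have hCr : ∀ (K N : ℝ) (a : ℕ → ℂ), 1 ≤ K → 1 / 2 ≤ N →
      Summable (fun c => ‖Tc r K N a c‖) ∧ ∑' c, ‖Tc r K N a c‖ ≤ C * K * N ^ (1 + 6 * ε) / r * l2 N a :=
    fun K N a hK hN => hC r K N a hr hK hN
  have hshells := shellSum_le hε hε1 hεε' hC0 hT hN hr
  rw [← hCδ, ← hB] at hshells
  set R : ℝ := T ^ 2 + N ^ (1 + ε') / r with hR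
  have hR0 : 0 ≤ R := by positivity
  have hR1 : 1 ≤ R := by
    have : 0 ≤ N ^ (1 + ε') / r := by positivity
    rw [hR]; nlinarith
  have hsumR : ∑ j ∈ Finset.range (shellJ T + 1), (shellK T j ^ 2 / (8 * Real.sqrt π) + C * N ^ (1 + 6 * ε) / r) * l2 N a ≤
      B * R * l2 N a := by
    rw [← Finset.sum_mul]; exact mul_le_mul_of_nonneg_right hshells hl2
  constructor
  · intro F Fe hF
    have hM := maass_shells_le hfam hCr hT hN a F hF
    have hX := exc_le hfam hCr hN a Fe
    -- the exceptional bound in terms of `R`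
    have hsπ : 0 < Real.sqrt π := Real.sqrt_pos.2 hπ
    have hsπ1 : 1 ≤ Real.sqrt π := by
      rw [show (1 : ℝ) = Real.sqrt 1 by simp]; exact Real.sqrt_le_sqrt (by linarith [Real.pi_gt_three])
    have hs2 : Real.sqrt 2 ≤ 2 := by
      rw [show (2 : ℝ) = Real.sqrt 4 by rw [show (4 : ℝ) = 2 ^ 2 by norm_num, Real.sqrt_sq (by norm_num)]]
      exact Real.sqrt_le_sqrt (by norm_num)
    have hs20 : 0 ≤ Real.sqrt 2 := Real.sqrt_nonneg 2
    have hNN : N ^ (1 + 6 * ε) / r ≤ 4 * R := by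
      have h4 := rpow_le_four_mul_rpow hN (by positivity : 0 ≤ 1 + 6 * ε) (by linarith : 1 + 6 * ε ≤ 1 + 12 * ε) (by linarith)
      have hW : N ^ (1 + 12 * ε) / r ≤ R := by
        rcases le_or_gt 1 N with h | h
        · have : N ^ (1 + 12 * ε) ≤ N ^ (1 + ε') := Real.rpow_le_rpow_of_exponent_le h (by linarith)
          have : N ^ (1 + 12 * ε) / r ≤ N ^ (1 + ε') / r := div_le_div_of_nonneg_right this hr0.le
          rw [hR]; linarith [sq_nonneg T]
        · have h2 : N ^ (1 + 12 * ε) ≤ 1 := Real.rpow_le_one hN0.le h.le (by linarith)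
          have h3 : N ^ (1 + 12 * ε) / r ≤ 1 := by rw [div_le_one hr0]; linarith [(by exact_mod_cast hr : (1 : ℝ) ≤ r)]
          linarith
      calc N ^ (1 + 6 * ε) / r ≤ 4 * N ^ (1 + 12 * ε) / r := by gcongr
        _ = 4 * (N ^ (1 + 12 * ε) / r) := by ring
        _ ≤ 4 * R := by gcongr
    have hXR : Real.sqrt 2 * (1 / (8 * Real.sqrt π) + C * N ^ (1 + 6 * ε) / r) * l2 N a ≤ 2 * (1 + 4 * C) * R * l2 N a := by
      refine mul_le_mul_of_nonneg_right ?_ hl2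
      have h1 : 1 / (8 * Real.sqrt π) ≤ R := by
        rw [div_le_iff₀ (by positivity)]; nlinarith
      have h2 : C * N ^ (1 + 6 * ε) / r ≤ C * (4 * R) := by
        rw [mul_div_assoc]; exact mul_le_mul_of_nonneg_left hNN hC0
      calc Real.sqrt 2 * (1 / (8 * Real.sqrt π) + C * N ^ (1 + 6 * ε) / r) ≤ 2 * (R + C * (4 * R)) := by gcongr
        _ = 2 * (1 + 4 * C) * R := by ring
    calc _ ≤ 4 * Real.exp 1 * (B * R * l2 N a) + 2 * (1 + 4 * C) * R * l2 N a := by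
          refine add_le_add (hM.trans ?_) (hX.trans hXR)
          exact mul_le_mul_of_nonneg_left hsumR (by positivity)
      _ ≤ (16 * π * Real.exp 1 * B + 2 * (1 + 4 * C)) * R * l2 N a := by
          have : 4 * Real.exp 1 ≤ 16 * π * Real.exp 1 := by nlinarith [Real.pi_gt_three, Real.exp_pos 1]
          have hBRl : 0 ≤ B * R * l2 N a := by positivity
          nlinarith
  · obtain ⟨hint, hE⟩ := eis_shells_le hfam hCr hT hN a
    refine ⟨hint, hE.trans ?_⟩
    calc 16 * π * Real.exp 1 * ∑ j ∈ Finset.range (shellJ T + 1), (shellK T j ^ 2 / (8 * Real.sqrt π) + C * N ^ (1 + 6 * ε) / r) * l2 N a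
        ≤ 16 * π * Real.exp 1 * (B * R * l2 N a) := mul_le_mul_of_nonneg_left hsumR (by positivity)
      _ ≤ (16 * π * Real.exp 1 * B + 2 * (1 + 4 * C)) * R * l2 N a := by
          have : 0 ≤ 2 * (1 + 4 * C) * R * l2 N a := by positivity
          nlinarith

end Spectral

end DeshouillersIwaniec

end Literature.NumberTheory.Sieve
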